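import Literature.MathematicalPhysics.QuantumFieldTheory.BalabanImbrieJaffe1984to88.BIJ88Sect2Statements

/-!
# `BalabanImbrieJaffe1984to88.BIJ88Close235Proof` — T. Bałaban, J. Imbrie, A. Jaffe, *Effective action and cluster properties
of the abelian Higgs model*, Commun. Math. Phys. **114** (1988) 257–315 [BalabanImbrieJaffe1988]: the hence-step of p. 263,
(2.34) ⟹ (2.35), (2.36), (2.37) — the kernel of the localized scalar form `Δ_{k,loc}(u) = a_kI − a_k²Q_k(u)G_{k,loc}(u)Q_k*(u)`
inherits closeness to `Δ_k(Ω,u)`, exponential decay and finite range from (2.31), (2.30) and the ζ″-cutoff (2.28)–(2.29) of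
`G_{k,loc}(u)` through the locality of the block averages `Q_k(u)`, `Q_k*(u)` — PROVED as kernel algebra

statement-level skeleton of published theorems with citation tags; proofs where landed; nothing here is a claim about the Yang–Mills mass gap

PDF held: `paper:balaban1988-cmp114-bij-abelian-higgs-effective-action` (journal page = PDF page + 256); pp. 263–264 [PDF 7–8]
read this session from the text layer (`lit read … --pages 7-9`); [2] = [BalabanImbrieJaffe1985] pp. 303–305
(`paper:balaban1985-cmp97-bij-higgs-minimizers`, (2.6), (2.9), (2.24)) for the averaging operators `Q`, `Q*`, `Q_k = Q^k`.

WHAT IS REPRODUCED.  SKELETON rows **C2.Eq2.35**, **C2.Eq2.36**, **C2.Eq2.37** (cell `lit-balaban`, HOME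
`run/shared/lean/pub/lit-balaban/`; Phase-2 seat p02 gen 3 = unit `lit-balaban-p02`, a G.2(b)/(c) knitting step taken after the
seat's rows B6.Eq2.36, B6.Eq2.91, C2.Eq2.11, C2.Eq2.15, C2.Eq2.20–2.22; C2 §§1–4 fold owner r18, referee ref-5; TAKING line
HOME/STATUS.md 2026-08-21T04:11:41Z).  Before this file (2.35)–(2.37) were the bare `def … : Prop`s `BIJ88Sect2Statements.Close235` /
`Decay` / `Vanishes` (typed p239939).
p. 263, verbatim: *"We then put G_{k,loc}(u;x₁,x₂) = ζ″_k(x₁,x₂)G̃_k(u;x₁,x₂), (2.28) where ζ″_k(x₁,x₂) is a smooth function of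
x₁ − x₂, ζ″_k(x₁,x₂) = 0, if |x₁ − x₂| ≧ (1/4L) r(e_{k−1}), 1, if |x₁ − x₂| ≦ (1/8L) r(e_{k−1}). (2.29) The boundary conditions
are always at a distance O(r(e_k)) from x₁, x₂, so a straightforward application of the random walk expansion of [6] shows that
|(G_{k,loc}(u)f)(x)| ≦ ce^{−c dist(suppt f,x)}‖f‖_∞, (2.30) |(G_{k,loc}(u)f − G_k(Ω,u)f)(x)| ≦ e^{−cr(e_k)}e^{−c dist(suppt f,x)}‖f‖_∞,
(2.31) for dist(x,Ω^c) ≧ O(r(e_k)). … We use G_{k,loc} to define a localized quadratic form for scalar fields, Δ_{k,loc}(u) = a_kI −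
a_k²Q_k(u)G_{k,loc}(u)Q_k^*(u). (2.34) Here we have simply replaced G_k(Ω,u) with G_{k,loc} in the definition of Δ_k(Ω,u); see
(I.4.6.4). Hence |Δ_{k,loc}(u;x₁,x₂) − Δ_k(Ω,u;x₁,x₂)| ≦ e^{−cr(e_k)}e^{−c|x₁−x₂|} for dist({x₁,x₂},Ω^c) > O(r(e_k)), (2.35)
|Δ_{k,loc}(u;x₁,x₂)| ≦ ce^{−c|x₁−x₂|}, (2.36) Δ_{k,loc}(u;x₁,x₂) = 0 if |x₁ − x₂| ≧ (1/2L) r(e_{k−1}). (2.37)"*; p. 264: *"Again we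
assume u is smooth in the relevant regions; Δ_{k,loc}(u;x₁,x₂) depends on u only in an O(r(e_k))-neighborhood of x₁, x₂."*
[2] (2.6) p. 303: *"The average Qφ of φ is defined by (Qφ)_y = Σ_{x∈B(y)} L^{−d}u(Γ_{yx})φ_x. (2.6)"*, (2.9) p. 303 *"QQ* = I"*,
(2.24) p. 305 *"We also need the k-fold averaging operators Q_k = (Q)^k"*.

WHAT IS PROVED HERE (0 `sorry`, standard axioms; kind «knitting step», abstract kernel carriers as in r18's typing + the u ≡ 1
block-average instance).
§1 KERNEL API for r18's operator vocabulary `applyK` / `supNorm` / `suppDist` (`supNorm_le`, `abs_le_supNorm`, `le_suppDist`,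
`abs_sum_mul_le`).
§2 THE KERNEL OF (2.34) on rectangular real kernels `Q : α × β` (unit-lattice sites ← η-lattice sites), `G : β × β`, `Q* : β × α`:
`qgqKer Q G Q*` = the kernel of `Q G Q*` (column of `Q*` fed to the operator `G`, then the row of `Q`: `qgqKer_eq_sum`), `deltaKer a_k Q G
Q* = a_kδ − a_k²·qgqKer` (both `Δ_{k,loc}(u)` at `G = G_{k,loc}(u)` and `Δ_k(Ω,u)` at `G = G_k(Ω,u)`, print's *"simply replaced"*:
`deltaKer_sub`); THE LOCALITY OF THE AVERAGES as the hypothesis record `IsLocalPair dα dβ Q Q* q₁ q∞ ρ`: row ℓ¹-norm of `Q` ≤ q₁, entries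
of `Q*` ≤ q∞, and the range glue `dist(x₁,x₂) ≤ dist(y₂,y₁) + 2ρ` whenever `Q(x₁,y₁) ≠ 0 ≠ Q*(y₂,x₂)` — for [2] (2.6)/(2.24) these are
q₁ = Σ_{y∈B^k(x)}η^d|u(Γ)| = 1, q∞ = |u(Γ)| = 1, ρ = the block diameter.
§3 THE HENCE-STEP.  **(2.31) ⟹ (2.35)**: `abs_qgqKer_sub_le` / `abs_deltaKer_sub_le` give, on the region `Far`,
`|Δ_{k,loc} − Δ_k(Ω)|(x₁,x₂) ≤ a_k²q₁q∞e^{2cρ}·e^{−cr(e_k)}e^{−c dist(x₁,x₂)}` from `OpClose231` for `(G_{k,loc}, G_k(Ω,u))` (the region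
condition transferring from {x₁,x₂} to the η-sites under x₁: hypothesis `hFar`), and **`close235_of_opClose231`** = the typed row
`BIJ88Sect2Statements.Close235 … c′ r(e_k)` for any rate `c′ ≤ c` absorbing the prefactor, `a_k²q₁q∞e^{2cρ} ≤ e^{(c−c′)r(e_k)}` («r(e_k)
large», print's convention that c changes from line to line); **(2.30) ⟹ (2.36)**: `abs_qgqKer_le` / `abs_deltaKer_le`
(`|Δ_{k,loc}(x₁,x₂)| ≤ |a_k|δ_{x₁x₂} + a_k²q₁q∞c e^{2cρ}e^{−c dist(x₁,x₂)}`) and **`decay236_of_opDecay`** = the typed row `Decay dα Δ_{k,loc} c′`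
in its one-constant shape (`|a_k| + a_k²q₁q∞ce^{2cρ} ≤ c′ ≤ c`); **(2.29) ⟹ (2.37)**: `vanishes237` (range R′ of `G_{k,loc}` + 2ρ ≤ R ⟹
`Vanishes dα Δ_{k,loc} R`) and **`vanishes237_of_zeta229`** = the typed row with the printed radii, `G_{k,loc} = ζ″G̃` ((2.28), r18's `loc`)
under `Zeta229` and `2ρ ≤ (1/4L)r(e_{k−1})`; the p. 264 sentence as `deltaKer_congr_local` (the entry at (x₁,x₂) sees `Q(u)(x₁,·)`,
`Q*(u)(·,x₂)` and `G_{k,loc}(u)` on the product of their supports only).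
§4 DICTIONARY to the ring-level typing: with `Q`, `G`, `Q*` embedded as blocks of `Matrix (α ⊕ β) (α ⊕ β) ℝ`, the αα-block of r18's
`BIJ88Sect2Statements.deltaLoc a_k Q G Q*` (= [I] (4.6.4) `BIJ85Sect4Statements.deltaScalar`) IS `deltaKer` (`deltaLoc_fromBlocks_toBlocks₁₁`,
`qgqKer_eq_mul`).
§5 THE u ≡ 1 INSTANCE of [2] (2.6): `qOne`/`qsOne` on a block map `blk : β → α` with fibres of size n (`qOne_row_l1`: q₁ = 1;
`qOne_mul_qsOne`: [2] (2.9) `QQ* = I`; `isLocalPair_qOne`: the hypothesis record holds with q₁ = q∞ = 1 given blocks of radius ρ).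
HONEST SCOPE.  (2.30), (2.31) (random walk expansion of [6]) and (2.38) ((I.7.3.2)) remain statement rows and enter only as the displayed
hypotheses `OpDecay` / `OpClose231`; the kernels are real-valued as in r18's typing (a U(1)-covariant complex kernel is read through its
realification, entry norms and supports unchanged); the constants of (2.35)/(2.36) are explicit here and absorbed into print's generic
`c` only under the stated largeness / one-constant conditions, which is how the print's convention reads; nothing on d = 4 or the
continuum; NOT summit progress.
-/

namespace Literature.MathematicalPhysics.QuantumFieldTheory.BalabanImbrieJaffe1984to88.BIJ88Close235Proof

open Finset BIJ88Sect2Statements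

noncomputable section

/-! ## §1  Kernel API for `applyK`, `supNorm`, `suppDist` -/

section API

variable {α β : Type*} [Fintype α]

/-- `‖f‖_∞ ≤ M` from a pointwise bound with `0 ≤ M` (also for an empty index type). [cite: BalabanImbrieJaffe1988, (2.13) p.261] -/
theorem supNorm_le {f : α → ℝ} {M : ℝ} (hM : 0 ≤ M) (h : ∀ a, |f a| ≤ M) : supNorm f ≤ M :=
  Real.iSup_le h hM

/-- `0 ≤ ‖f‖_∞`. [cite: BalabanImbrieJaffe1988, (2.13) p.261] -/
theorem supNorm_nonneg (f : α → ℝ) : 0 ≤ supNorm f :=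
  Real.iSup_nonneg fun a => abs_nonneg (f a)

/-- `|f(a)| ≤ ‖f‖_∞`. [cite: BalabanImbrieJaffe1988, (2.13) p.261] -/
theorem abs_le_supNorm (f : α → ℝ) (a : α) : |f a| ≤ supNorm f :=
  le_ciSup (Finite.bddAbove_range fun a => |f a|) a

omit [Fintype α] in
/-- A lower bound of `dist(suppt f, b)`: if `f ≠ 0` and every point of the support is at distance `≥ m` from `b`.
[cite: BalabanImbrieJaffe1988, (2.13) p.261] -/
theorem le_suppDist {dist : α → β → ℝ} {f : α → ℝ} {b : β} {m : ℝ} (hne : ∃ a, f a ≠ 0)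
    (h : ∀ a, f a ≠ 0 → m ≤ dist a b) : m ≤ suppDist dist f b := by
  obtain ⟨a₀, ha₀⟩ := hne
  haveI : Nonempty {a // f a ≠ 0} := ⟨⟨a₀, ha₀⟩⟩
  exact le_ciInf fun a => h a.1 a.2

/-- Weighted sums: `|Σ_i w_i D_i| ≤ (Σ_i |w_i|)·B` when `|D_i| ≤ B` on the support of `w`. [cite: BalabanImbrieJaffe1988, (2.34) p.263] -/
theorem abs_sum_mul_le {ι : Type*} [Fintype ι] (w D : ι → ℝ) {B : ℝ}
    (hD : ∀ i, w i ≠ 0 → |D i| ≤ B) : |∑ i, w i * D i| ≤ (∑ i, |w i|) * B := by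
  calc |∑ i, w i * D i| ≤ ∑ i, |w i * D i| := Finset.abs_sum_le_sum_abs _ _
    _ ≤ ∑ i, |w i| * B := by
      refine Finset.sum_le_sum fun i _ => ?_
      by_cases hw : w i = 0
      · simp [hw]
      · rw [abs_mul]
        exact mul_le_mul_of_nonneg_left (hD i hw) (abs_nonneg _)
    _ = (∑ i, |w i|) * B := by rw [Finset.sum_mul]

end API

/-! ## §2  The kernel of (2.34) and the locality of the averages -/

section Kernel

variable {α β : Type*} [Fintype β]

/-- The kernel of `Q G Q*` for rectangular real kernels `Q : α × β`, `G : β × β`, `Q* : β × α`: the column `Q*(·,x₂)` fed to the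
operator `G` (r18's `applyK`), then the row `Q(x₁,·)`. [cite: BalabanImbrieJaffe1988, (2.34) p.263] -/
def qgqKer (Q : α → β → ℝ) (G : β → β → ℝ) (Qs : β → α → ℝ) : α → α → ℝ :=
  fun x₁ x₂ => ∑ y₁, Q x₁ y₁ * applyK G (fun y₂ => Qs y₂ x₂) y₁

/-- `(QGQ*)(x₁,x₂) = Σ_{y₁,y₂} Q(x₁,y₁)G(y₁,y₂)Q*(y₂,x₂)`. [cite: BalabanImbrieJaffe1988, (2.34) p.263] -/
theorem qgqKer_eq_sum (Q : α → β → ℝ) (G : β → β → ℝ) (Qs : β → α → ℝ) (x₁ x₂ : α) :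
    qgqKer Q G Qs x₁ x₂ = ∑ y₁, ∑ y₂, Q x₁ y₁ * G y₁ y₂ * Qs y₂ x₂ := by
  simp only [qgqKer, applyK, Finset.mul_sum, mul_assoc]

variable [DecidableEq α] in
/-- **(2.34) as a kernel**: `Δ(u) = a_kI − a_k²Q_k(u) G Q_k*(u)` at a scalar propagator `G` — `Δ_{k,loc}(u)` at `G = G_{k,loc}(u)`,
`Δ_k(Ω,u)` ((I.4.6.4)) at `G = G_k(Ω,u)`. [cite: BalabanImbrieJaffe1988, (2.34) p.263] -/
def deltaKer (ak : ℝ) (Q : α → β → ℝ) (G : β → β → ℝ) (Qs : β → α → ℝ) : α → α → ℝ :=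
  fun x₁ x₂ => ak * (if x₁ = x₂ then 1 else 0) - ak ^ 2 * qgqKer Q G Qs x₁ x₂

/-- *"we have simply replaced G_k(Ω,u) with G_{k,loc}"*: the difference of the two (2.34)-kernels is `−a_k²Q(G_loc − G)Q*`.
[cite: BalabanImbrieJaffe1988, (2.34) p.263] -/
theorem deltaKer_sub [DecidableEq α] (ak : ℝ) (Q : α → β → ℝ) (Gloc G : β → β → ℝ) (Qs : β → α → ℝ) (x₁ x₂ : α) :
    deltaKer ak Q Gloc Qs x₁ x₂ - deltaKer ak Q G Qs x₁ x₂
      = -(ak ^ 2 * (qgqKer Q Gloc Qs x₁ x₂ - qgqKer Q G Qs x₁ x₂)) := by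
  simp only [deltaKer]
  ring

/-- The kernel difference `Q(G_loc − G)Q*` entrywise, as the row of `Q` against `(G_loc − G)` applied to the column of `Q*`.
[cite: BalabanImbrieJaffe1988, (2.34) p.263] -/
theorem qgqKer_sub (Q : α → β → ℝ) (Gloc G : β → β → ℝ) (Qs : β → α → ℝ) (x₁ x₂ : α) :
    qgqKer Q Gloc Qs x₁ x₂ - qgqKer Q G Qs x₁ x₂
      = ∑ y₁, Q x₁ y₁ * (applyK Gloc (fun y₂ => Qs y₂ x₂) y₁ - applyK G (fun y₂ => Qs y₂ x₂) y₁) := by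
  simp only [qgqKer, ← Finset.sum_sub_distrib, mul_sub]

/-- **Locality of the block averages** `Q = Q_k(u)`, `Q* = Q_k*(u)` relative to distances `dα` (unit lattice) and `dβ` (η-lattice):
the rows of `Q` have ℓ¹-norm `≤ q₁`, the entries of `Q*` are `≤ q∞` in absolute value, and an entry `Q(x₁,y₁) ≠ 0 ≠ Q*(y₂,x₂)` forces
`dist(x₁,x₂) ≤ dist(y₂,y₁) + 2ρ` (both averages have range ρ).  For [2] (2.6)/(2.24), `(Q_k(u)φ)(x) = Σ_{y∈B^k(x)}η^d u(Γ_{x,y})φ(y)`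
with `|u| = 1`: `q₁ = 1`, `q∞ = 1`, `ρ` = the block diameter. [cite: BalabanImbrieJaffe1985, (2.6) p.303] -/
structure IsLocalPair (dα : α → α → ℝ) (dβ : β → β → ℝ) (Q : α → β → ℝ) (Qs : β → α → ℝ) (q₁ qinf ρ : ℝ) : Prop where
  row_l1 : ∀ x, ∑ y, |Q x y| ≤ q₁
  col_sup : ∀ y x, |Qs y x| ≤ qinf
  qinf_nonneg : 0 ≤ qinf
  glue : ∀ x₁ x₂ y₁ y₂, Q x₁ y₁ ≠ 0 → Qs y₂ x₂ ≠ 0 → dα x₁ x₂ ≤ dβ y₂ y₁ + 2 * ρ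

variable {dα : α → α → ℝ} {dβ : β → β → ℝ} {Q : α → β → ℝ} {Qs : β → α → ℝ} {q₁ qinf ρ c : ℝ}

/-- The range glue inside the exponential: for `Q(x₁,y₁) ≠ 0` and a nonzero column `Q*(·,x₂)`,
`e^{−c·dist(suppt Q*(·,x₂), y₁)} ≤ e^{2cρ}e^{−c·dist(x₁,x₂)}`. [cite: BalabanImbrieJaffe1988, (2.35) p.263] -/
theorem exp_suppDist_col_le (hQ : IsLocalPair dα dβ Q Qs q₁ qinf ρ) (hc : 0 ≤ c) {x₁ x₂ : α} {y₁ : β}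
    (hy₁ : Q x₁ y₁ ≠ 0) (hne : ∃ y₂, Qs y₂ x₂ ≠ 0) :
    Real.exp (-c * suppDist dβ (fun y₂ => Qs y₂ x₂) y₁)
      ≤ Real.exp (2 * c * ρ) * Real.exp (-c * dα x₁ x₂) := by
  have hsd : dα x₁ x₂ - 2 * ρ ≤ suppDist dβ (fun y₂ => Qs y₂ x₂) y₁ :=
    le_suppDist hne fun y₂ hy₂ => by linarith [hQ.glue x₁ x₂ y₁ y₂ hy₁ hy₂]
  rw [← Real.exp_add]
  apply Real.exp_le_exp.2
  have h := mul_le_mul_of_nonneg_left hsd hc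
  rw [mul_sub] at h
  linarith

/-- **(2.31) ⟹ the kernel estimate behind (2.35)**: on the region `Far` (transferred to the η-sites under `x₁` by `hFar`),
`|Q(G_{k,loc} − G_k(Ω,u))Q*|(x₁,x₂) ≤ q₁q∞e^{2cρ}·e^{−cr(e_k)}·e^{−c dist(x₁,x₂)}`. [cite: BalabanImbrieJaffe1988, (2.35) p.263] -/
theorem abs_qgqKer_sub_le (hQ : IsLocalPair dα dβ Q Qs q₁ qinf ρ) (hc : 0 ≤ c) {Gloc G : β → β → ℝ}
    {Farβ : β → Prop} {Farα : α → α → Prop} {rek : ℝ} (h231 : OpClose231 dβ Farβ Gloc G c rek)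
    (hFar : ∀ x₁ x₂, Farα x₁ x₂ → ∀ y₁, Q x₁ y₁ ≠ 0 → Farβ y₁) {x₁ x₂ : α} (hx : Farα x₁ x₂) :
    |qgqKer Q Gloc Qs x₁ x₂ - qgqKer Q G Qs x₁ x₂|
      ≤ q₁ * qinf * Real.exp (2 * c * ρ) * Real.exp (-c * rek) * Real.exp (-c * dα x₁ x₂) := by
  rw [qgqKer_sub]
  have hq0 : 0 ≤ qinf := hQ.qinf_nonneg
  have hB : 0 ≤ Real.exp (-c * rek) * (Real.exp (2 * c * ρ) * Real.exp (-c * dα x₁ x₂)) * qinf := by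
    positivity
  have hD : ∀ y₁, Q x₁ y₁ ≠ 0 →
      |applyK Gloc (fun y₂ => Qs y₂ x₂) y₁ - applyK G (fun y₂ => Qs y₂ x₂) y₁|
        ≤ Real.exp (-c * rek) * (Real.exp (2 * c * ρ) * Real.exp (-c * dα x₁ x₂)) * qinf := by
    intro y₁ hy₁
    by_cases hne : ∃ y₂, Qs y₂ x₂ ≠ 0
    · have h1 := h231 (fun y₂ => Qs y₂ x₂) y₁ (hFar x₁ x₂ hx y₁ hy₁)
      have hsN : supNorm (fun y₂ => Qs y₂ x₂) ≤ qinf := supNorm_le hq0 fun y₂ => hQ.col_sup y₂ x₂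
      have hsD := exp_suppDist_col_le hQ hc hy₁ hne
      refine h1.trans (mul_le_mul ?_ hsN (supNorm_nonneg _) (by positivity))
      exact mul_le_mul_of_nonneg_left hsD (Real.exp_pos _).le
    · push Not at hne
      simp only [applyK, hne, mul_zero, Finset.sum_const_zero, sub_self, abs_zero]
      exact hB
  calc |∑ y₁, Q x₁ y₁ * (applyK Gloc (fun y₂ => Qs y₂ x₂) y₁ - applyK G (fun y₂ => Qs y₂ x₂) y₁)|
      ≤ (∑ y₁, |Q x₁ y₁|) * (Real.exp (-c * rek) * (Real.exp (2 * c * ρ) * Real.exp (-c * dα x₁ x₂)) * qinf) :=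
        abs_sum_mul_le _ _ hD
    _ ≤ q₁ * (Real.exp (-c * rek) * (Real.exp (2 * c * ρ) * Real.exp (-c * dα x₁ x₂)) * qinf) :=
        mul_le_mul_of_nonneg_right (hQ.row_l1 x₁) hB
    _ = q₁ * qinf * Real.exp (2 * c * ρ) * Real.exp (-c * rek) * Real.exp (-c * dα x₁ x₂) := by ring

/-- **(2.30) ⟹ the kernel estimate behind (2.36)**: `|QG_{k,loc}Q*|(x₁,x₂) ≤ q₁q∞c e^{2cρ}e^{−c dist(x₁,x₂)}`.
[cite: BalabanImbrieJaffe1988, (2.36) p.263] -/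
theorem abs_qgqKer_le (hQ : IsLocalPair dα dβ Q Qs q₁ qinf ρ) (hc : 0 ≤ c) {Gloc : β → β → ℝ}
    (h230 : OpDecay dβ Gloc c) (x₁ x₂ : α) :
    |qgqKer Q Gloc Qs x₁ x₂| ≤ q₁ * qinf * c * Real.exp (2 * c * ρ) * Real.exp (-c * dα x₁ x₂) := by
  have hq0 : 0 ≤ qinf := hQ.qinf_nonneg
  have hB : 0 ≤ c * (Real.exp (2 * c * ρ) * Real.exp (-c * dα x₁ x₂)) * qinf := by positivity
  have hD : ∀ y₁, Q x₁ y₁ ≠ 0 →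
      |applyK Gloc (fun y₂ => Qs y₂ x₂) y₁| ≤ c * (Real.exp (2 * c * ρ) * Real.exp (-c * dα x₁ x₂)) * qinf := by
    intro y₁ hy₁
    by_cases hne : ∃ y₂, Qs y₂ x₂ ≠ 0
    · have h1 := h230 (fun y₂ => Qs y₂ x₂) y₁
      have hsN : supNorm (fun y₂ => Qs y₂ x₂) ≤ qinf := supNorm_le hq0 fun y₂ => hQ.col_sup y₂ x₂
      have hsD := exp_suppDist_col_le hQ hc hy₁ hne
      refine h1.trans (mul_le_mul ?_ hsN (supNorm_nonneg _) (by positivity))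
      exact mul_le_mul_of_nonneg_left hsD hc
    · push Not at hne
      simp only [applyK, hne, mul_zero, Finset.sum_const_zero, abs_zero]
      exact hB
  calc |qgqKer Q Gloc Qs x₁ x₂|
      = |∑ y₁, Q x₁ y₁ * applyK Gloc (fun y₂ => Qs y₂ x₂) y₁| := rfl
    _ ≤ (∑ y₁, |Q x₁ y₁|) * (c * (Real.exp (2 * c * ρ) * Real.exp (-c * dα x₁ x₂)) * qinf) :=
        abs_sum_mul_le _ _ hD
    _ ≤ q₁ * (c * (Real.exp (2 * c * ρ) * Real.exp (-c * dα x₁ x₂)) * qinf) :=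
        mul_le_mul_of_nonneg_right (hQ.row_l1 x₁) hB
    _ = q₁ * qinf * c * Real.exp (2 * c * ρ) * Real.exp (-c * dα x₁ x₂) := by ring

/-! ## §3  The hence-step: (2.35), (2.36), (2.37) -/

/-- **(2.35) with the explicit constant**: on the region, `|Δ_{k,loc}(u) − Δ_k(Ω,u)|(x₁,x₂) ≤ a_k²q₁q∞e^{2cρ}·e^{−cr(e_k)}e^{−c dist(x₁,x₂)}`.
[cite: BalabanImbrieJaffe1988, (2.35) p.263] -/
theorem abs_deltaKer_sub_le [DecidableEq α] (hQ : IsLocalPair dα dβ Q Qs q₁ qinf ρ) (hc : 0 ≤ c) {Gloc G : β → β → ℝ}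
    {Farβ : β → Prop} {Farα : α → α → Prop} {rek : ℝ} (h231 : OpClose231 dβ Farβ Gloc G c rek)
    (hFar : ∀ x₁ x₂, Farα x₁ x₂ → ∀ y₁, Q x₁ y₁ ≠ 0 → Farβ y₁) (ak : ℝ) {x₁ x₂ : α} (hx : Farα x₁ x₂) :
    |deltaKer ak Q Gloc Qs x₁ x₂ - deltaKer ak Q G Qs x₁ x₂|
      ≤ ak ^ 2 * (q₁ * qinf * Real.exp (2 * c * ρ)) * Real.exp (-c * rek) * Real.exp (-c * dα x₁ x₂) := by
  rw [deltaKer_sub, abs_neg, abs_mul, abs_of_nonneg (sq_nonneg ak)]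
  have h := abs_qgqKer_sub_le hQ hc h231 hFar hx
  calc ak ^ 2 * |qgqKer Q Gloc Qs x₁ x₂ - qgqKer Q G Qs x₁ x₂|
      ≤ ak ^ 2 * (q₁ * qinf * Real.exp (2 * c * ρ) * Real.exp (-c * rek) * Real.exp (-c * dα x₁ x₂)) :=
        mul_le_mul_of_nonneg_left h (sq_nonneg _)
    _ = ak ^ 2 * (q₁ * qinf * Real.exp (2 * c * ρ)) * Real.exp (-c * rek) * Real.exp (-c * dα x₁ x₂) := by ring

/-- **(2.35), THE TYPED ROW `Close235`**, from (2.31) `OpClose231` for `(G_{k,loc}(u), G_k(Ω,u))` and the locality of the averages, in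
print's one-constant shape: for any rate `c′ ≤ c` with the prefactor absorbed by «r(e_k) large», `a_k²q₁q∞e^{2cρ} ≤ e^{(c−c′)r(e_k)}`,
`|Δ_{k,loc}(u;x₁,x₂) − Δ_k(Ω,u;x₁,x₂)| ≤ e^{−c′r(e_k)}e^{−c′ dist(x₁,x₂)}` on the region `Far`. [cite: BalabanImbrieJaffe1988, (2.35) p.263] -/
theorem close235_of_opClose231 [DecidableEq α] (hQ : IsLocalPair dα dβ Q Qs q₁ qinf ρ) (hc : 0 ≤ c) {Gloc G : β → β → ℝ}
    {Farβ : β → Prop} {Farα : α → α → Prop} {rek : ℝ} (h231 : OpClose231 dβ Farβ Gloc G c rek)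
    (hFar : ∀ x₁ x₂, Farα x₁ x₂ → ∀ y₁, Q x₁ y₁ ≠ 0 → Farβ y₁) (hdα : ∀ x₁ x₂, 0 ≤ dα x₁ x₂) (ak : ℝ)
    {c' : ℝ} (hc'c : c' ≤ c) (hlarge : ak ^ 2 * (q₁ * qinf * Real.exp (2 * c * ρ)) ≤ Real.exp ((c - c') * rek)) :
    Close235 dα Farα (deltaKer ak Q Gloc Qs) (deltaKer ak Q G Qs) c' rek := by
  intro x₁ x₂ hx
  refine (abs_deltaKer_sub_le hQ hc h231 hFar ak hx).trans ?_
  have h1 : ak ^ 2 * (q₁ * qinf * Real.exp (2 * c * ρ)) * Real.exp (-c * rek) ≤ Real.exp (-c' * rek) := by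
    calc ak ^ 2 * (q₁ * qinf * Real.exp (2 * c * ρ)) * Real.exp (-c * rek)
        ≤ Real.exp ((c - c') * rek) * Real.exp (-c * rek) :=
          mul_le_mul_of_nonneg_right hlarge (Real.exp_pos _).le
      _ = Real.exp (-c' * rek) := by
          rw [← Real.exp_add]
          ring_nf
  have h2 : Real.exp (-c * dα x₁ x₂) ≤ Real.exp (-c' * dα x₁ x₂) :=
    Real.exp_le_exp.2 (by nlinarith [hdα x₁ x₂])
  exact mul_le_mul h1 h2 (Real.exp_pos _).le (Real.exp_pos _).le

/-- **(2.36) with the explicit constants**: `|Δ_{k,loc}(u;x₁,x₂)| ≤ |a_k|δ_{x₁x₂} + a_k²q₁q∞c e^{2cρ}e^{−c dist(x₁,x₂)}` from (2.30) `OpDecay`.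
[cite: BalabanImbrieJaffe1988, (2.36) p.263] -/
theorem abs_deltaKer_le [DecidableEq α] (hQ : IsLocalPair dα dβ Q Qs q₁ qinf ρ) (hc : 0 ≤ c) {Gloc : β → β → ℝ}
    (h230 : OpDecay dβ Gloc c) (ak : ℝ) (x₁ x₂ : α) :
    |deltaKer ak Q Gloc Qs x₁ x₂|
      ≤ |ak| * (if x₁ = x₂ then 1 else 0) + ak ^ 2 * (q₁ * qinf * c * Real.exp (2 * c * ρ)) * Real.exp (-c * dα x₁ x₂) := by
  have h := abs_qgqKer_le hQ hc h230 x₁ x₂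
  have hδ : |ak * (if x₁ = x₂ then 1 else 0)| = |ak| * (if x₁ = x₂ then 1 else 0) := by
    split_ifs <;> simp
  calc |deltaKer ak Q Gloc Qs x₁ x₂|
      = |ak * (if x₁ = x₂ then 1 else 0) - ak ^ 2 * qgqKer Q Gloc Qs x₁ x₂| := rfl
    _ ≤ |ak * (if x₁ = x₂ then 1 else 0)| + |ak ^ 2 * qgqKer Q Gloc Qs x₁ x₂| := abs_sub _ _
    _ = |ak| * (if x₁ = x₂ then 1 else 0) + ak ^ 2 * |qgqKer Q Gloc Qs x₁ x₂| := by
        rw [hδ, abs_mul, abs_of_nonneg (sq_nonneg ak)]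
    _ ≤ |ak| * (if x₁ = x₂ then 1 else 0)
          + ak ^ 2 * (q₁ * qinf * c * Real.exp (2 * c * ρ) * Real.exp (-c * dα x₁ x₂)) := by
        gcongr
    _ = |ak| * (if x₁ = x₂ then 1 else 0)
          + ak ^ 2 * (q₁ * qinf * c * Real.exp (2 * c * ρ)) * Real.exp (-c * dα x₁ x₂) := by ring

/-- **(2.36), THE TYPED ROW `Decay`**, from (2.30) `OpDecay` for `G_{k,loc}(u)` and the locality of the averages, in the one-constant
shape of r18's typing `|Δ_{k,loc}(x₁,x₂)| ≤ c′e^{−c′ dist(x₁,x₂)}` (`dist(x,x) = 0`): for any `c′ ≤ c` dominating the prefactor,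
`|a_k| + a_k²q₁q∞ce^{2cρ} ≤ c′`. [cite: BalabanImbrieJaffe1988, (2.36) p.263] -/
theorem decay236_of_opDecay [DecidableEq α] (hQ : IsLocalPair dα dβ Q Qs q₁ qinf ρ) (hc : 0 ≤ c) {Gloc : β → β → ℝ}
    (h230 : OpDecay dβ Gloc c) (hdα : ∀ x₁ x₂, 0 ≤ dα x₁ x₂) (hdiag : ∀ x, dα x x = 0) (ak : ℝ)
    {c' : ℝ} (hc'c : c' ≤ c) (hK : |ak| + ak ^ 2 * (q₁ * qinf * c * Real.exp (2 * c * ρ)) ≤ c') :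
    Decay dα (deltaKer ak Q Gloc Qs) c' := by
  intro x₁ x₂
  have h := abs_deltaKer_le hQ hc h230 ak x₁ x₂
  have hM : 0 ≤ ak ^ 2 * (q₁ * qinf * c * Real.exp (2 * c * ρ)) := by
    have hq1 : 0 ≤ q₁ := (Finset.sum_nonneg fun y _ => abs_nonneg (Q x₁ y)).trans (hQ.row_l1 x₁)
    have := hQ.qinf_nonneg
    positivity
  have hc'0 : 0 ≤ c' := le_trans (by positivity) hK
  by_cases h12 : x₁ = x₂
  · subst h12
    rw [if_pos rfl, mul_one, hdiag, mul_zero, Real.exp_zero, mul_one] at h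
    rw [hdiag, mul_zero, Real.exp_zero, mul_one]
    exact h.trans hK
  · rw [if_neg h12, mul_zero, zero_add] at h
    refine h.trans (mul_le_mul ?_ ?_ (Real.exp_pos _).le hc'0)
    · linarith [abs_nonneg ak]
    · exact Real.exp_le_exp.2 (by nlinarith [hdα x₁ x₂])

/-- **(2.37)**: if `G_{k,loc}(y₁,y₂) = 0` beyond distance `R′` (symmetric η-lattice distance) and `R′ + 2ρ ≤ R`, then
`Δ_{k,loc}(u;x₁,x₂) = 0` beyond distance `R` (`dist(x,x) < R` for the diagonal term `a_kI`). [cite: BalabanImbrieJaffe1988, (2.37) p.263] -/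
theorem vanishes237 [DecidableEq α] (hQ : IsLocalPair dα dβ Q Qs q₁ qinf ρ) (hsymm : ∀ y y', dβ y y' = dβ y' y)
    {Gloc : β → β → ℝ} {R' R : ℝ} (hG : Vanishes dβ Gloc R') (hRR : R' + 2 * ρ ≤ R)
    (hdiag : ∀ x, dα x x < R) (ak : ℝ) :
    Vanishes dα (deltaKer ak Q Gloc Qs) R := by
  intro x₁ x₂ hx
  have hne : x₁ ≠ x₂ := by
    rintro rfl
    exact absurd hx (not_le.2 (hdiag x₁))
  have hq : qgqKer Q Gloc Qs x₁ x₂ = 0 := by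
    rw [qgqKer_eq_sum]
    refine Finset.sum_eq_zero fun y₁ _ => Finset.sum_eq_zero fun y₂ _ => ?_
    by_cases h1 : Q x₁ y₁ = 0
    · simp [h1]
    by_cases h2 : Qs y₂ x₂ = 0
    · simp [h2]
    have hglue := hQ.glue x₁ x₂ y₁ y₂ h1 h2
    rw [hsymm y₂ y₁] at hglue
    have hfar : R' ≤ dβ y₁ y₂ := by linarith
    simp [hG y₁ y₂ hfar]
  simp [deltaKer, hne, hq]

/-- **(2.37), THE TYPED ROW with the printed radii**: for `G_{k,loc} = ζ″_kG̃_k` ((2.28), r18's `loc`) with the cutoff (2.29)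
`Zeta229` (ζ″ = 0 beyond `(1/4L)r(e_{k−1})`) and averages of range `ρ` with `(1/4L)r(e_{k−1}) + 2ρ ≤ (1/2L)r(e_{k−1})`,
`Δ_{k,loc}(u;x₁,x₂) = 0` for `dist(x₁,x₂) ≧ (1/2L)r(e_{k−1})`. [cite: BalabanImbrieJaffe1988, (2.37) p.263] -/
theorem vanishes237_of_zeta229 [DecidableEq α] (hQ : IsLocalPair dα dβ Q Qs q₁ qinf ρ) (hsymm : ∀ y y', dβ y y' = dβ y' y)
    {ζ'' Gt : β → β → ℝ} {L rekm1 : ℝ} (hζ : Zeta229 dβ L rekm1 ζ'')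
    (hρ : rekm1 / (4 * L) + 2 * ρ ≤ rekm1 / (2 * L)) (hdiag : ∀ x, dα x x < rekm1 / (2 * L)) (ak : ℝ) :
    Vanishes dα (deltaKer ak Q (loc ζ'' Gt) Qs) (rekm1 / (2 * L)) :=
  vanishes237 hQ hsymm (loc_vanishes hζ Gt) hρ hdiag ak

/-- p. 264, *"Δ_{k,loc}(u;x₁,x₂) depends on u only in an O(r(e_k))-neighborhood of x₁, x₂"*: the entry at `(x₁,x₂)` sees only the
row `Q(u)(x₁,·)`, the column `Q*(u)(·,x₂)` and `G_{k,loc}(u)` on the product of their supports — two families of kernels agreeing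
there give the same entry. [cite: BalabanImbrieJaffe1988, (2.37) p.264] -/
theorem deltaKer_congr_local [DecidableEq α] {Q Q' : α → β → ℝ} {G G' : β → β → ℝ} {Qs Qs' : β → α → ℝ} {x₁ x₂ : α}
    (hQ : ∀ y, Q x₁ y = Q' x₁ y) (hQs : ∀ y, Qs y x₂ = Qs' y x₂)
    (hG : ∀ y₁ y₂, Q x₁ y₁ ≠ 0 → Qs y₂ x₂ ≠ 0 → G y₁ y₂ = G' y₁ y₂) (ak : ℝ) :
    deltaKer ak Q G Qs x₁ x₂ = deltaKer ak Q' G' Qs' x₁ x₂ := by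
  simp only [deltaKer, qgqKer_eq_sum]
  congr 2
  refine Finset.sum_congr rfl fun y₁ _ => Finset.sum_congr rfl fun y₂ _ => ?_
  by_cases h1 : Q x₁ y₁ = 0
  · have h1' : Q' x₁ y₁ = 0 := (hQ y₁).symm.trans h1
    simp [h1, h1']
  · by_cases h2 : Qs y₂ x₂ = 0
    · have h2' : Qs' y₂ x₂ = 0 := (hQs y₂).symm.trans h2
      simp [h2, h2']
    · rw [hG y₁ y₂ h1 h2, hQ y₁, hQs y₂]

end Kernel

/-! ## §4  Dictionary to the ring-level typing `BIJ88Sect2Statements.deltaLoc` -/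

section Dictionary

variable {α β : Type*} [Fintype α] [Fintype β] [DecidableEq α] [DecidableEq β]

omit [Fintype α] [DecidableEq α] [DecidableEq β] in
/-- `qgqKer` IS the product of the three rectangular matrices. [cite: BalabanImbrieJaffe1988, (2.34) p.263] -/
theorem qgqKer_eq_mul (Q : α → β → ℝ) (G : β → β → ℝ) (Qs : β → α → ℝ) (x₁ x₂ : α) :
    qgqKer Q G Qs x₁ x₂ = (Matrix.of Q * Matrix.of G * Matrix.of Qs) x₁ x₂ := by
  rw [qgqKer_eq_sum, Matrix.mul_apply, Finset.sum_comm]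
  refine Finset.sum_congr rfl fun y₂ _ => ?_
  rw [Matrix.mul_apply, Finset.sum_mul]
  rfl

/-- **The ring-level (2.34) IS the kernel (2.34)**: in the ring `Matrix (α ⊕ β) (α ⊕ β) ℝ`, with `Q` (block αβ), `G` (block ββ),
`Q*` (block βα) embedded by `Matrix.fromBlocks`, the unit-site block of r18's `deltaLoc a_k Q G Q* = a_k·1 − a_k²·QGQ*` (= [I] (4.6.4)
`BIJ85Sect4Statements.deltaScalar`) is `deltaKer`. [cite: BalabanImbrieJaffe1988, (2.34) p.263] -/
theorem deltaLoc_fromBlocks_toBlocks₁₁ (ak : ℝ) (Q : α → β → ℝ) (G : β → β → ℝ) (Qs : β → α → ℝ) :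
    (BIJ88Sect2Statements.deltaLoc ak (Matrix.fromBlocks 0 (Matrix.of Q) 0 (0 : Matrix β β ℝ))
        (Matrix.fromBlocks (0 : Matrix α α ℝ) 0 0 (Matrix.of G))
        (Matrix.fromBlocks 0 0 (Matrix.of Qs) (0 : Matrix β β ℝ))).toBlocks₁₁
      = Matrix.of (deltaKer ak Q G Qs) := by
  have hprod : Matrix.fromBlocks 0 (Matrix.of Q) 0 (0 : Matrix β β ℝ) * Matrix.fromBlocks (0 : Matrix α α ℝ) 0 0 (Matrix.of G)
        * Matrix.fromBlocks 0 0 (Matrix.of Qs) (0 : Matrix β β ℝ)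
      = Matrix.fromBlocks (Matrix.of Q * Matrix.of G * Matrix.of Qs) 0 0 (0 : Matrix β β ℝ) := by
    simp [Matrix.fromBlocks_multiply]
  unfold BIJ88Sect2Statements.deltaLoc BIJ85Sect4Statements.deltaScalar
  rw [hprod, Algebra.algebraMap_eq_smul_one, Algebra.algebraMap_eq_smul_one]
  ext x₁ x₂
  simp [Matrix.toBlocks₁₁, deltaKer, qgqKer_eq_mul, Matrix.one_apply]

end Dictionary

/-! ## §5  The u ≡ 1 instance of the averages ([2] (2.6), (2.9)) -/

section BlockAverage

variable {α β : Type*} [Fintype β] [DecidableEq α]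

/-- The block average at `u ≡ 1` ([2] (2.6) in axial gauge: *"Qφ reduces to the ordinary average of φ"*), k-fold ((2.24)): a block
map `blk : β → α` (η-site ↦ the unit site of its block), blocks of `n` sites, `Q(x,y) = n⁻¹·[blk y = x]`.
[cite: BalabanImbrieJaffe1985, (2.6) p.303] -/
def qOne (blk : β → α) (n : ℕ) : α → β → ℝ := fun x y => if blk y = x then ((n : ℝ))⁻¹ else 0

/-- Its adjoint in the weighted scalar products, `Q*(y,x) = [blk y = x]` (constant extension to the block).
[cite: BalabanImbrieJaffe1985, (2.6) p.303] -/
def qsOne (blk : β → α) : β → α → ℝ := fun y x => if blk y = x then 1 else 0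

/-- Row ℓ¹-norm of the block average = 1 (blocks of `n ≥ 1` sites). [cite: BalabanImbrieJaffe1985, (2.6) p.303] -/
theorem qOne_row_l1 (blk : β → α) {n : ℕ} (hn : 0 < n)
    (hfib : ∀ x, (Finset.univ.filter fun y => blk y = x).card = n) (x : α) :
    ∑ y, |qOne blk n x y| = 1 := by
  have h : ∀ y, |qOne blk n x y| = if blk y = x then ((n : ℝ))⁻¹ else 0 := fun y => by
    unfold qOne
    split_ifs <;> simp
  simp_rw [h]
  rw [Finset.sum_ite, Finset.sum_const_zero, add_zero, Finset.sum_const, hfib x, nsmul_eq_mul]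
  exact mul_inv_cancel₀ (Nat.cast_ne_zero.2 hn.ne')

/-- [2] (2.9) `QQ* = I` for the u ≡ 1 block average. [cite: BalabanImbrieJaffe1985, (2.9) p.303] -/
theorem qOne_mul_qsOne (blk : β → α) {n : ℕ} (hn : 0 < n)
    (hfib : ∀ x, (Finset.univ.filter fun y => blk y = x).card = n) (x x' : α) :
    ∑ y, qOne blk n x y * qsOne blk y x' = if x = x' then 1 else 0 := by
  by_cases hxx : x = x'
  · subst hxx
    have h : ∀ y, qOne blk n x y * qsOne blk y x = if blk y = x then ((n : ℝ))⁻¹ else 0 := fun y => by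
      unfold qOne qsOne
      split_ifs <;> simp
    rw [if_pos rfl]
    simp_rw [h]
    rw [Finset.sum_ite, Finset.sum_const_zero, add_zero, Finset.sum_const, hfib x, nsmul_eq_mul]
    exact mul_inv_cancel₀ (Nat.cast_ne_zero.2 hn.ne')
  · rw [if_neg hxx]
    refine Finset.sum_eq_zero fun y _ => ?_
    unfold qOne qsOne
    by_cases h1 : blk y = x
    · have h2 : blk y ≠ x' := fun h2 => hxx (h1.symm.trans h2)
      simp [h2]
    · simp [h1]

/-- The locality record for the u ≡ 1 averages: `q₁ = q∞ = 1`, range glue from blocks of radius `ρ`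
(`dist(blk y₁, blk y₂) ≤ dist(y₂,y₁) + 2ρ`). [cite: BalabanImbrieJaffe1985, (2.6) p.303] -/
theorem isLocalPair_qOne (blk : β → α) {n : ℕ} (hn : 0 < n)
    (hfib : ∀ x, (Finset.univ.filter fun y => blk y = x).card = n) {dα : α → α → ℝ} {dβ : β → β → ℝ} {ρ : ℝ}
    (hblk : ∀ y₁ y₂, dα (blk y₁) (blk y₂) ≤ dβ y₂ y₁ + 2 * ρ) :
    IsLocalPair dα dβ (qOne blk n) (qsOne blk) 1 1 ρ where
  row_l1 x := (qOne_row_l1 blk hn hfib x).le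
  col_sup y x := by
    unfold qsOne
    split_ifs <;> simp
  qinf_nonneg := zero_le_one
  glue x₁ x₂ y₁ y₂ h1 h2 := by
    have e1 : blk y₁ = x₁ := by
      by_contra h
      exact h1 (by simp [qOne, h])
    have e2 : blk y₂ = x₂ := by
      by_contra h
      exact h2 (by simp [qsOne, h])
    rw [← e1, ← e2]
    exact hblk y₁ y₂

end BlockAverage

end

end Literature.MathematicalPhysics.QuantumFieldTheory.BalabanImbrieJaffe1984to88.BIJ88Close235Proof
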